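import Literature.NumberTheory.Automorphic.PadicallyAutomorphicResidualEigensystem
import Literature.NumberTheory.Automorphic.ReciprocityGLnQlModelProofs
import Literature.NumberTheory.GaloisRepresentations.CompactImageCharpolyIntegral
import HarnessLib

/-!
# A point of `𝕋(K^p)` associated with a Galois representation takes values in a finite `E/ℚ_p`

Topic `NumberTheory/Automorphic`; namespace `Literature.NumberTheory.Automorphic.BigHeckeGLn`
(grouping sub-namespace of the object `𝕋(K^p) = CompletedCohomologyHeckeAlgebraGLn 𝒰`).
THEOREMS ONLY (no definition, no named fact, no `sorry`).

Companion of `PadicallyAutomorphicResidualEigensystem` (continuous points are integral; the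
residual eigensystem).  Here: the first sentence of rendering (a) of
`Literature.NumberTheory.Automorphic.Pan2022_proModularDeRhamClassical_GL2Q` — "`x(𝕋(K^p))` is a
compact subring of `ℚ̄_p`, hence inside some `𝒪_E`, `E/ℚ_p` finite" — for a CONTINUOUS point
`x : 𝕋(K^p) → ℚ̄_p` ASSOCIATED with a continuous `ρ : Γ_K → GL_n(ℚ̄_p)` (`TameLevel.IsAssociated`).
In the tree's model `𝕋(K^p)` is not known to be compact (that is the finiteness of the
`H^i(X_{U_r}, ℤ/p^s)`), so the proof goes through `ρ` instead:

1. **Generators of `𝕋(K^p)`** (`[GeeNewton2020, §2.1.1]`; the relations left implicit in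
   `CompletedCohomologyHeckeAlgebraGLn`, whose docstring calls the operator of `t_{v,n}⁻¹` "an
   inverse of `T_{v,n}`"): `heckeEnd_one`, `heckeOnCohomology_one`, **`TameLevel.heckeOperator_one`**
   (`[U 1 U] = 1`); `heckeEnd_mul_of_central`, `heckeOnCohomology_mul_of_central`,
   **`TameLevel.heckeOperator_mul_heckeOperator_of_central`** (`T_g T_z = T_{zg}` for central `z`,
   from the tree's `heckeAlgebra.doubleCosetOperator_central_mul`, Shimura Prop. 3.17, through the
   transpose and `H^i`); `heckeElement_zero_eq_one`, `heckeElement_eq_of_le`; in `𝕋(K^p)`: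
   `TameLevel.heckeT_zero` (`T_{v,0} = 1`), `TameLevel.heckeT_eq_of_le` (`T_{v,i} = T_{v,n}`,
   `i ≥ n`), `TameLevel.heckeOperator_inv_mul_heckeT`, `TameLevel.heckeT_mul_heckeOperator_inv`,
   **`TameLevel.isUnit_heckeT`** (`T_{v,n}` is a unit with inverse the operator of `t_{v,n}⁻¹`).
   (The same identities were proved Summits-side, for one route, in
   `Summits/Langlands/Langlands/Theorems/SkinnerWilesDefectOneProModularOfEisensteinSeedHeckeGenerators.lean`
   (namespace `Summit.Langlands.Langlands.Theorems`, same short names), which `Literature/` cannot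
   import; this is their importable home next to the object, and that file can be migrated to these.)
2. `coeff_heckeFrobPoly` — the coefficient of `X^{n-i}` in `P_v(a)` is `(-1)^i q^{i(i-1)/2} a_i`
   (`1 ≤ i ≤ n`).
3. **`TameLevel.forall_apply_mem_of_heckeGenerators`** — a continuous `x : 𝕋(K^p) → ℚ̄_p` whose
   values on the generators lie in an intermediate field `E` (closed in `ℚ̄_p` by Krasner,
   `isClosed_intermediateField_padicAlgCl`) takes ALL its values in `E`: `x⁻¹(E)` is a closed subring
   of `𝕋(K^p)` containing the dense subring generated by the generators.
4. **`TameLevel.IsAssociated.exists_intermediateField_forall_apply_mem`** — if `x` is continuous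
   and associated with `ρ`, there is a FINITE `E/ℚ_p` inside `ℚ̄_p` with `x(𝕋(K^p)) ⊆ E`: take a
   finite model `ρ ≅ r_E ⊗ ℚ̄_p` (`exists_hasQlModel_holds`, Baire); the Frobenius characteristic
   polynomials of `ρ` have coefficients in `E` (`charpoly` is a conjugation invariant and commutes
   with base change), so `x(T_{v,i}) = ± q_v^{-i(i-1)/2} · coeff ∈ E` for `1 ≤ i ≤ n`
   (`apply_heckeT_mem_of_forall_coeff_mem`), `x(T_{v,0}) = 1`, `x(T_{v,i}) = x(T_{v,n})` for
   `i ≥ n`, `x([U t_{v,n}⁻¹ U]) = x(T_{v,n})⁻¹ ∈ E`; conclude by 3.  With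
   `TameLevel.norm_apply_le_one` the values lie in `𝒪_E = E ∩ ℤ̄_p`
   (**`TameLevel.IsPadicallyAutomorphic.exists_intermediateField`**).

## References

* T. Gee, J. Newton, *Patching and the completed homology of locally symmetric spaces*,
  J. Inst. Math. Jussieu (2020), §2.1.1, §2.1.3. [GeeNewton2020]
* G. Shimura, *Introduction to the arithmetic theory of automorphic functions* (1971), Prop. 3.17
  (central elements in Hecke rings). [ShimuraIATAF1971]
* C. Skinner, Doc. Math. 14 (2009), §2, p. 244 (values in a finite extension, Baire). [Skinner2009]
* L. Pan, Forum Math. Pi 10 (2022), §6.1.1 (`λ : 𝕋(K^p) → ℚ̄_p` lands in a finite extension).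
  [Pan2022LocallyAnalytic]
-/

noncomputable section

open scoped NumberField
open IsDedekindDomain Field Polynomial CategoryTheory
open Literature.NumberTheory.GaloisRepresentations

namespace Literature.NumberTheory.Automorphic

namespace BigHeckeGLn

variable {n : ℕ} {K : Type} [Field K] [NumberField K]

/-! ### `heckeFrobPoly`: coefficients -/

/-- The coefficient of `X^{n-i}` in `heckeFrobPoly n q a` is `(-1)^i q^{i(i-1)/2} a_i` for
`1 ≤ i ≤ n`. [cite: GeeNewton2020, §3.3, Conj. 3.3.2] -/
theorem coeff_heckeFrobPoly {A : Type*} [Ring A] (m q : ℕ) (a : ℕ → A) {i : ℕ} (h1 : 1 ≤ i)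
    (hi : i ≤ m) :
    (heckeFrobPoly m q a).coeff (m - i) = (-1) ^ i * (q : A) ^ (i * (i - 1) / 2) * a i := by
  unfold heckeFrobPoly
  rw [Polynomial.coeff_add, Polynomial.coeff_X_pow, if_neg (by omega), zero_add,
    Polynomial.finsetSum_coeff, Finset.sum_eq_single i]
  · rw [Polynomial.coeff_C_mul, Polynomial.coeff_X_pow, if_pos rfl, mul_one]
  · intro j hj hji
    rw [Finset.mem_Icc] at hj
    rw [Polynomial.coeff_C_mul, Polynomial.coeff_X_pow, if_neg (by omega), mul_zero]
  · intro h
    exact absurd (Finset.mem_Icc.2 ⟨h1, hi⟩) h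

/-! ### The Hecke elements `t_{v,0} = 1`, `t_{v,i} = t_{v,n}` (`i ≥ n`) -/

/-- `t_{v,0} = 1`. [folklore] -/
theorem heckeElement_zero_eq_one (v : HeightOneSpectrum (𝓞 K)) : heckeElement n K v 0 = 1 := by
  have h : (fun l : Fin n => if l.val < 0 then uniformizerIdele K v (uniformizerAt v) else 1) = 1 :=
    funext fun l => if_neg (Nat.not_lt_zero _)
  rw [heckeElement, h, map_one]

/-- `t_{v,i} = t_{v,n}` for `i ≥ n` (documented junk-free convention of `heckeElement`). [folklore] -/
theorem heckeElement_eq_of_le (v : HeightOneSpectrum (𝓞 K)) {i : ℕ} (h : n ≤ i) :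
    heckeElement n K v i = heckeElement n K v n := by
  unfold heckeElement
  congr 1
  funext l
  rw [if_pos (lt_of_lt_of_le l.isLt h), if_pos l.isLt]

/-! ### Relations among the Hecke operators at one level: `[U1U] = 1`, central elements -/

section Level

variable (U : Subgroup (FiniteAdelicGL n K)) (k : Type) [CommRing k]
  [IsHeckeTriple (⊤ : Submonoid (FiniteAdelicGL n K)) U U]

/-- `[U 1 U]` is the identity on `Fun(GL_n(𝔸_K^∞)/U, k)` (`heckeAlgebra.doubleCosetOperator_one`,
transposed). [folklore] -/
theorem heckeEnd_one : heckeEnd U k 1 = 1 := by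
  change ((heckeAlgebra.doubleCosetOperator U (1 : FiniteAdelicGL n K) :
      heckeAlgebra k (FiniteAdelicGL n K) U) :
    Module.End k (MonoidAlgebra k (FiniteAdelicGL n K ⧸ U))).dualMap = 1
  rw [heckeAlgebra.doubleCosetOperator_one, OneMemClass.coe_one, Module.End.one_eq_id,
    LinearMap.dualMap_id]
  rfl

/-- **`[UgU] ∘ [UzU] = [U zg U]` on `Fun(GL_n(𝔸_K^∞)/U, k)` for central `z`** (transpose of
`T_z T_g = T_{zg}`, `heckeAlgebra.doubleCosetOperator_central_mul`; the transpose reverses the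
order). [cite: ShimuraIATAF1971, Prop. 3.17] -/
theorem heckeEnd_mul_of_central {z : FiniteAdelicGL n K} (hz : ∀ x, x * z = z * x)
    (g : FiniteAdelicGL n K) : heckeEnd U k g * heckeEnd U k z = heckeEnd U k (z * g) := by
  change ((heckeAlgebra.doubleCosetOperator U g : heckeAlgebra k (FiniteAdelicGL n K) U) :
      Module.End k (MonoidAlgebra k (FiniteAdelicGL n K ⧸ U))).dualMap *
    ((heckeAlgebra.doubleCosetOperator U z : heckeAlgebra k (FiniteAdelicGL n K) U) :
      Module.End k (MonoidAlgebra k (FiniteAdelicGL n K ⧸ U))).dualMap =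
    ((heckeAlgebra.doubleCosetOperator U (z * g) : heckeAlgebra k (FiniteAdelicGL n K) U) :
      Module.End k (MonoidAlgebra k (FiniteAdelicGL n K ⧸ U))).dualMap
  rw [Module.End.mul_eq_comp, LinearMap.dualMap_comp_dualMap, ← Module.End.mul_eq_comp,
    ← MulMemClass.coe_mul, heckeAlgebra.doubleCosetOperator_central_mul U hz g]

/-- `[U 1 U] = 1` on `H^i(X_U, k)` (functoriality of `groupCohomology`). [folklore] -/
theorem heckeOnCohomology_one (i : ℕ) : heckeOnCohomology U k 1 i = 1 := by
  have hrep : Rep.ofHom (heckeIntertwining U k 1) = 𝟙 (Rep.of (levelRep U k)) :=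
    Rep.hom_ext (Representation.IntertwiningMap.ext (by
      change heckeEnd U k 1 = LinearMap.id
      rw [heckeEnd_one]
      rfl))
  change ((groupCohomology.functor k (GL (Fin n) K) i).map
    (Rep.ofHom (heckeIntertwining U k 1))).hom = 1
  rw [hrep, CategoryTheory.Functor.map_id, ModuleCat.hom_id]
  rfl

/-- **`[UgU] ∘ [UzU] = [U zg U]` on `H^i(X_U, k)` for central `z`.** [cite: ShimuraIATAF1971, Prop. 3.17] -/
theorem heckeOnCohomology_mul_of_central {z : FiniteAdelicGL n K} (hz : ∀ x, x * z = z * x)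
    (g : FiniteAdelicGL n K) (i : ℕ) :
    heckeOnCohomology U k g i * heckeOnCohomology U k z i = heckeOnCohomology U k (z * g) i := by
  have hrep : Rep.ofHom (heckeIntertwining U k z) ≫ Rep.ofHom (heckeIntertwining U k g) =
      Rep.ofHom (heckeIntertwining U k (z * g)) :=
    Rep.hom_ext (Representation.IntertwiningMap.ext (heckeEnd_mul_of_central U k hz g))
  have := congrArg (fun f => ((groupCohomology.functor k (GL (Fin n) K) i).map f).hom) hrep
  simp only [Functor.map_comp, ModuleCat.hom_comp] at this
  exact this

end Level

namespace TameLevel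

variable {p : ℕ} [Fact p.Prime] (𝒰 : TameLevel n K p)

/-! ### The same relations in `∏ End(H^i(X_{U_r}, ℤ/p^s))` and in `𝕋(K^p)` -/

/-- `𝒰.heckeOperator 1 = 1`. [folklore] -/
theorem heckeOperator_one : 𝒰.heckeOperator 1 = 1 := by
  funext idx
  exact heckeOnCohomology_one (𝒰.tower idx.1) (ZMod (p ^ idx.2.1)) idx.2.2

/-- **`T_g T_z = T_{zg}` in the product ring for central `z`.** [cite: ShimuraIATAF1971, Prop. 3.17] -/
theorem heckeOperator_mul_heckeOperator_of_central {z : FiniteAdelicGL n K}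
    (hz : ∀ x, x * z = z * x) (g : FiniteAdelicGL n K) :
    𝒰.heckeOperator g * 𝒰.heckeOperator z = 𝒰.heckeOperator (z * g) := by
  funext idx
  exact heckeOnCohomology_mul_of_central (𝒰.tower idx.1) (ZMod (p ^ idx.2.1)) hz g idx.2.2

/-- The operator of `t_{v,n}⁻¹` composed with `T_{v,n}` is the identity (both elements are central).
[cite: GeeNewton2020, §2.1.1] -/
theorem heckeOperator_inv_mul_self (v : HeightOneSpectrum (𝓞 K)) :
    𝒰.heckeOperator (heckeElement n K v n)⁻¹ * 𝒰.heckeOperator (heckeElement n K v n) = 1 := by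
  rw [𝒰.heckeOperator_mul_heckeOperator_of_central (fun x => (heckeElement_self_mul_comm v x).symm),
    mul_inv_cancel, heckeOperator_one]

/-- `T_{v,n}` composed with the operator of `t_{v,n}⁻¹` is the identity. [cite: GeeNewton2020, §2.1.1] -/
theorem heckeOperator_self_mul_inv (v : HeightOneSpectrum (𝓞 K)) :
    𝒰.heckeOperator (heckeElement n K v n) * 𝒰.heckeOperator (heckeElement n K v n)⁻¹ = 1 := by
  have hz : ∀ x, x * (heckeElement n K v n)⁻¹ = (heckeElement n K v n)⁻¹ * x := fun x =>
    (Commute.inv_left (heckeElement_self_mul_comm v x)).eq.symm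
  rw [𝒰.heckeOperator_mul_heckeOperator_of_central hz, inv_mul_cancel, heckeOperator_one]

/-- `T_{v,0} = 1` in `𝕋(K^p)` (`v ∉ S`). [folklore] -/
theorem heckeT_zero {v : HeightOneSpectrum (𝓞 K)} (hv : v ∉ 𝒰.bad) : 𝒰.heckeT v 0 = 1 :=
  Subtype.ext (by rw [coe_heckeT 𝒰 hv, heckeElement_zero_eq_one, heckeOperator_one]; rfl)

/-- `T_{v,i} = T_{v,n}` in `𝕋(K^p)` for `i ≥ n`. [folklore] -/
theorem heckeT_eq_of_le (v : HeightOneSpectrum (𝓞 K)) {i : ℕ} (h : n ≤ i) :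
    𝒰.heckeT v i = 𝒰.heckeT v n := by
  classical
  by_cases hv : v ∈ 𝒰.bad
  · rw [heckeT, heckeT, dif_pos hv, dif_pos hv]
  · exact Subtype.ext (by rw [coe_heckeT 𝒰 hv, coe_heckeT 𝒰 hv, heckeElement_eq_of_le v h])

/-- The operator of `t_{v,n}⁻¹` lies in `𝕋(K^p)` (`v ∉ S`; it is a generator). [folklore] -/
theorem heckeOperator_inv_mem {v : HeightOneSpectrum (𝓞 K)} (hv : v ∉ 𝒰.bad) :
    𝒰.heckeOperator (heckeElement n K v n)⁻¹ ∈ 𝒰.bigHeckeSubring :=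
  (Subring.closure 𝒰.heckeGenerators).le_topologicalClosure
    (Subring.subset_closure (Or.inr ⟨v, hv, rfl⟩))

/-- `[U t_{v,n}⁻¹ U] · T_{v,n} = 1` in `𝕋(K^p)`. [cite: GeeNewton2020, §2.1.1] -/
theorem heckeOperator_inv_mul_heckeT {v : HeightOneSpectrum (𝓞 K)} (hv : v ∉ 𝒰.bad) :
    (⟨𝒰.heckeOperator (heckeElement n K v n)⁻¹, 𝒰.heckeOperator_inv_mem hv⟩ :
        CompletedCohomologyHeckeAlgebraGLn 𝒰) * 𝒰.heckeT v n = 1 :=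
  Subtype.ext (by
    rw [MulMemClass.coe_mul, coe_heckeT 𝒰 hv, OneMemClass.coe_one]
    exact 𝒰.heckeOperator_inv_mul_self v)

/-- `T_{v,n} · [U t_{v,n}⁻¹ U] = 1` in `𝕋(K^p)`. [cite: GeeNewton2020, §2.1.1] -/
theorem heckeT_mul_heckeOperator_inv {v : HeightOneSpectrum (𝓞 K)} (hv : v ∉ 𝒰.bad) :
    𝒰.heckeT v n * (⟨𝒰.heckeOperator (heckeElement n K v n)⁻¹, 𝒰.heckeOperator_inv_mem hv⟩ :
        CompletedCohomologyHeckeAlgebraGLn 𝒰) = 1 :=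
  Subtype.ext (by
    rw [MulMemClass.coe_mul, coe_heckeT 𝒰 hv, OneMemClass.coe_one]
    exact 𝒰.heckeOperator_self_mul_inv v)

/-- **`T_{v,n}` is a unit of `𝕋(K^p)`** (`v ∉ S`), with inverse the operator of the central element
`t_{v,n}⁻¹` — the relation presupposed by the generating set of `CompletedCohomologyHeckeAlgebraGLn`.
[cite: GeeNewton2020, §2.1.1 and §2.1.3] -/
theorem isUnit_heckeT {v : HeightOneSpectrum (𝓞 K)} (hv : v ∉ 𝒰.bad) : IsUnit (𝒰.heckeT v n) :=
  isUnit_iff_exists.2 ⟨_, 𝒰.heckeT_mul_heckeOperator_inv hv, 𝒰.heckeOperator_inv_mul_heckeT hv⟩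

/-- A ring homomorphism on `𝕋(K^p)` sends the operator of `t_{v,n}⁻¹` to the inverse of its value
on `T_{v,n}` (values in a division ring). [folklore] -/
theorem apply_heckeOperator_inv_eq_inv {A : Type*} [DivisionRing A]
    (x : CompletedCohomologyHeckeAlgebraGLn 𝒰 →+* A) {v : HeightOneSpectrum (𝓞 K)} (hv : v ∉ 𝒰.bad) :
    x ⟨𝒰.heckeOperator (heckeElement n K v n)⁻¹, 𝒰.heckeOperator_inv_mem hv⟩ = (x (𝒰.heckeT v n))⁻¹ :=
  eq_inv_of_mul_eq_one_left (by rw [← map_mul, 𝒰.heckeOperator_inv_mul_heckeT hv, map_one])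

/-! ### Values on the generators in a closed subfield ⟹ all values in it -/

/-- **A continuous `x : 𝕋(K^p) → ℚ̄_p` with generator values in an intermediate field `E` takes
all its values in `E`.**  `E` is closed in `ℚ̄_p` (`isClosed_intermediateField_padicAlgCl`, Krasner),
so `x⁻¹(E)` is a closed subring of `𝕋(K^p)`; its image in the product ring is closed (as `𝕋(K^p)`
is) and contains the subring generated by the generators, hence its closure `𝕋(K^p)`.
[cite: Skinner2009, §2 (p. 244)] -/
theorem forall_apply_mem_of_heckeGenerators (x : CompletedCohomologyHeckeAlgebraGLn 𝒰 →+* PadicAlgCl p)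
    (hxc : Continuous x) (E : IntermediateField ℚ_[p] (PadicAlgCl p))
    (hgen : ∀ (g : 𝒰.bigEnd) (hg : g ∈ 𝒰.heckeGenerators),
      x ⟨g, (Subring.closure 𝒰.heckeGenerators).le_topologicalClosure (Subring.subset_closure hg)⟩ ∈ E)
    (t : CompletedCohomologyHeckeAlgebraGLn 𝒰) : x t ∈ E := by
  -- the closed subring `R = x⁻¹(E)` of `𝕋(K^p)` and its (closed) image `R'` in the product ring
  set R : Subring (CompletedCohomologyHeckeAlgebraGLn 𝒰) := E.toSubring.comap x with hR
  have hRclosed : IsClosed (R : Set (CompletedCohomologyHeckeAlgebraGLn 𝒰)) :=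
    (isClosed_intermediateField_padicAlgCl E).preimage hxc
  set R' : Subring 𝒰.bigEnd := R.map 𝒰.bigHeckeSubring.subtype with hR'
  have hR'closed : IsClosed (R' : Set 𝒰.bigEnd) := by
    rw [hR', Subring.coe_map]
    exact (Subring.isClosed_topologicalClosure _).isClosedEmbedding_subtypeVal.isClosedMap _ hRclosed
  have hle : Subring.closure 𝒰.heckeGenerators ≤ R' := by
    rw [Subring.closure_le]
    intro g hg
    exact Subring.mem_map.2 ⟨⟨g, _⟩, hgen g hg, rfl⟩
  have hT : 𝒰.bigHeckeSubring ≤ R' := Subring.topologicalClosure_minimal _ hle hR'closed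
  obtain ⟨r, hr, hrt⟩ := Subring.mem_map.1 (hT t.2)
  have hrt' : r = t := Subtype.ext hrt
  rw [← hrt']
  exact hr

/-! ### Frobenius coefficients in `E` ⟹ `x(T_{v,i}) ∈ E` -/

/-- If `x` is associated with `ρ` and all coefficients of all `charpoly ρ(σ)` lie in the subfield
`E ⊆ ℚ̄_p`, then `x(T_{v,i}) ∈ E` for `v ∉ S`, `1 ≤ i ≤ n`: an arithmetic Frobenius `σ` at some
`𝔓 ∣ v` exists (`exists_isArithFrobAt_of_mem_primesAbove_holds`), and the coefficient of `X^{n-i}`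
in `charpoly ρ(σ) = P_v(x)` is `(-1)^i q_v^{i(i-1)/2} x(T_{v,i})` with `q_v ≠ 0`.
[cite: GeeNewton2020, §3.3, Conj. 3.3.2] -/
theorem apply_heckeT_mem_of_forall_coeff_mem {x : CompletedCohomologyHeckeAlgebraGLn 𝒰 →+* PadicAlgCl p}
    {ρ : FramedGaloisRep K (PadicAlgCl p) n} (hx : 𝒰.IsAssociated x ρ)
    (E : IntermediateField ℚ_[p] (PadicAlgCl p))
    (hcoef : ∀ (σ : absoluteGaloisGroup K) (j : ℕ), (FramedRep.charpoly ρ σ).coeff j ∈ E)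
    {v : HeightOneSpectrum (𝓞 K)} (hv : v ∉ 𝒰.bad) {i : ℕ} (h1 : 1 ≤ i) (hi : i ≤ n) :
    x (𝒰.heckeT v i) ∈ E := by
  obtain ⟨𝔓, h𝔓⟩ := IsDedekindDomain.HeightOneSpectrum.primesAbove_nonempty v
  obtain ⟨σ, hσ⟩ := IsDedekindDomain.HeightOneSpectrum.exists_isArithFrobAt_of_mem_primesAbove_holds h𝔓
  have hchar := (hx v hv).2 𝔓 h𝔓 σ hσ
  have hc := hcoef σ (n - i)
  rw [hchar, coeff_heckeFrobPoly n _ _ h1 hi] at hc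
  set q : ℕ := Ideal.absNorm v.asIdeal with hq
  have hq0 : q ≠ 0 := fun h => v.ne_bot (Ideal.absNorm_eq_zero_iff.1 h)
  set c : PadicAlgCl p := (-1) ^ i * (q : PadicAlgCl p) ^ (i * (i - 1) / 2) with hcdef
  have hcE : c ∈ E := mul_mem (pow_mem (neg_mem (one_mem E)) i) (pow_mem (natCast_mem E q) _)
  have hc0 : c ≠ 0 :=
    mul_ne_zero (pow_ne_zero _ (neg_ne_zero.2 one_ne_zero)) (pow_ne_zero _ (Nat.cast_ne_zero.2 hq0))
  have e : x (𝒰.heckeT v i) = c⁻¹ * (c * x (𝒰.heckeT v i)) := by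
    rw [← mul_assoc, inv_mul_cancel₀ hc0, one_mul]
  rw [e]
  exact mul_mem (inv_mem hcE) hc

/-! ### The values of a point associated with `ρ` lie in a finite extension of `ℚ_p` -/

omit [NumberField K] in
/-- The Frobenius characteristic polynomials of `ρ` have coefficients in the field of a finite
model: if `ρ = P (r_E ⊗ ℚ̄_p) P⁻¹` (`HasQlModel ρ E r_E`), then
`charpoly ρ(σ) = charpoly r_E(σ) ⊗ ℚ̄_p`. [cite: BuzzardGeeLMS2014, §2.2] -/
theorem charpoly_coeff_mem_of_hasQlModel {ρ : FramedGaloisRep K (PadicAlgCl p) n}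
    {E : IntermediateField ℚ_[p] (PadicAlgCl p)} {rE : FramedGaloisRep K E n}
    (h : HasQlModel ρ E rE) (σ : absoluteGaloisGroup K) (j : ℕ) :
    (FramedRep.charpoly ρ σ).coeff j ∈ E := by
  obtain ⟨P, hP⟩ := h
  have hρσ : ρ σ = P * Matrix.GeneralLinearGroup.map (algebraMap E (PadicAlgCl p)) (rE σ) * P⁻¹ := by
    rw [← hP]
    rfl
  have hcp : FramedRep.charpoly ρ σ =
      (((rE σ : GL (Fin n) E) : Matrix (Fin n) (Fin n) E).charpoly).map (algebraMap E (PadicAlgCl p)) := by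
    unfold FramedRep.charpoly
    rw [hρσ, Units.val_mul, Units.val_mul, Matrix.coe_units_inv, Matrix.charpoly_units_conj,
      ← Matrix.charpoly_map]
    rfl
  rw [hcp, Polynomial.coeff_map]
  exact SetLike.coe_mem _

/-- **The values of a continuous point associated with `ρ` lie in a finite extension of `ℚ_p`.**
If `x : 𝕋(K^p) → ℚ̄_p` is continuous and associated with `ρ : Γ_K → GL_n(ℚ̄_p)`, there is an
intermediate field `ℚ_p ⊆ E ⊆ ℚ̄_p`, finite over `ℚ_p`, with `x(t) ∈ E` for every `t ∈ 𝕋(K^p)`: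
`ρ` has a model over a finite `E` (`exists_hasQlModel_holds`), so the `charpoly ρ(Frob_v)` have
coefficients in `E`, hence so do the values of `x` on all generators `T_{v,i}`, `[U t_{v,n}⁻¹ U]`
(`T_{v,0} = 1`, `T_{v,i} = T_{v,n}` for `i ≥ n`, `x([U t_{v,n}⁻¹ U]) = x(T_{v,n})⁻¹`), and by
continuity and Krasner on all of `𝕋(K^p)` (`forall_apply_mem_of_heckeGenerators`).
[cite: Skinner2009, §2 (p. 244)] [cite: Pan2022LocallyAnalytic, §6.1.1] -/
theorem IsAssociated.exists_intermediateField_forall_apply_mem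
    {x : CompletedCohomologyHeckeAlgebraGLn 𝒰 →+* PadicAlgCl p} (hxc : Continuous x)
    {ρ : FramedGaloisRep K (PadicAlgCl p) n} (hx : 𝒰.IsAssociated x ρ) :
    ∃ E : IntermediateField ℚ_[p] (PadicAlgCl p), FiniteDimensional ℚ_[p] E ∧
      ∀ t : CompletedCohomologyHeckeAlgebraGLn 𝒰, x t ∈ E := by
  obtain ⟨E, rE, hfin, hmodel⟩ := exists_hasQlModel_holds ρ
  refine ⟨E, hfin, 𝒰.forall_apply_mem_of_heckeGenerators x hxc E fun g hg => ?_⟩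
  have hcoef := charpoly_coeff_mem_of_hasQlModel hmodel
  -- values on `T_{v,i}`, all `i`
  have hT : ∀ (v : HeightOneSpectrum (𝓞 K)) (hv : v ∉ 𝒰.bad) (i : ℕ), x (𝒰.heckeT v i) ∈ E := by
    intro v hv i
    rcases Nat.eq_zero_or_pos i with rfl | hi0
    · rw [𝒰.heckeT_zero hv, map_one]
      exact one_mem E
    by_cases hin : i ≤ n
    · exact 𝒰.apply_heckeT_mem_of_forall_coeff_mem hx E hcoef hv hi0 hin
    · rw [𝒰.heckeT_eq_of_le v (le_of_not_ge hin)]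
      rcases Nat.eq_zero_or_pos n with hn | hn
      · have h0 : 𝒰.heckeT v n = 1 := by
          have := 𝒰.heckeT_zero hv
          rwa [← hn] at this
        rw [h0, map_one]
        exact one_mem E
      · exact 𝒰.apply_heckeT_mem_of_forall_coeff_mem hx E hcoef hv hn le_rfl
  rcases hg with ⟨v, hv, i, rfl⟩ | ⟨v, hv, rfl⟩
  · have e : (⟨𝒰.heckeOperator (heckeElement n K v i),
        (Subring.closure 𝒰.heckeGenerators).le_topologicalClosure
          (Subring.subset_closure (Or.inl ⟨v, hv, i, rfl⟩))⟩ :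
          CompletedCohomologyHeckeAlgebraGLn 𝒰) = 𝒰.heckeT v i :=
      Subtype.ext (coe_heckeT 𝒰 hv i).symm
    rw [e]
    exact hT v hv i
  · have e : (⟨𝒰.heckeOperator (heckeElement n K v n)⁻¹,
        (Subring.closure 𝒰.heckeGenerators).le_topologicalClosure
          (Subring.subset_closure (Or.inr ⟨v, hv, rfl⟩))⟩ :
          CompletedCohomologyHeckeAlgebraGLn 𝒰) =
        ⟨𝒰.heckeOperator (heckeElement n K v n)⁻¹, 𝒰.heckeOperator_inv_mem hv⟩ := rfl
    rw [e, 𝒰.apply_heckeOperator_inv_eq_inv x hv]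
    exact inv_mem (hT v hv n)

/-- **A `p`-adically automorphic `ρ` has an `𝒪_E`-valued eigensystem, `E/ℚ_p` finite** (the first
sentence of rendering (a) of `Pan2022_proModularDeRhamClassical_GL2Q`): if `ρ : Γ_K → GL_n(ℚ̄_p)` is
`p`-adically automorphic of tame level `𝒰`, there are a continuous point `x : 𝕋(K^p) → ℚ̄_p`
associated with `ρ` and a finite `E/ℚ_p` inside `ℚ̄_p` such that every value `x(t)` lies in `E` and
in `ℤ̄_p` (`TameLevel.norm_apply_le_one`), i.e. in `𝒪_E`.
[cite: Pan2022LocallyAnalytic, §6.1.1] [cite: KhareThorne2017, §6.5] -/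
theorem IsPadicallyAutomorphic.exists_intermediateField {ρ : FramedGaloisRep K (PadicAlgCl p) n}
    (hρ : 𝒰.IsPadicallyAutomorphic ρ) :
    ∃ (x : CompletedCohomologyHeckeAlgebraGLn 𝒰 →+* PadicAlgCl p)
      (E : IntermediateField ℚ_[p] (PadicAlgCl p)),
      Continuous x ∧ 𝒰.IsAssociated x ρ ∧ FiniteDimensional ℚ_[p] E ∧
      ∀ t : CompletedCohomologyHeckeAlgebraGLn 𝒰, x t ∈ E ∧ x t ∈ padicAlgClIntegers p := by
  obtain ⟨x, hxc, hx⟩ := hρ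
  obtain ⟨E, hfin, hE⟩ := IsAssociated.exists_intermediateField_forall_apply_mem 𝒰 hxc hx
  exact ⟨x, E, hxc, hx, hfin, fun t => ⟨hE t, 𝒰.apply_mem_padicAlgClIntegers x hxc t⟩⟩

end TameLevel

end BigHeckeGLn

end Literature.NumberTheory.Automorphic
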